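import Mathlib
import Summits.Ventures.PercRepro2.HCov
import Summits.Ventures.PercRepro2.EdgeCubic
import Summits.Ventures.PercRepro2.EdgeCubicAll
import Summits.Ventures.PercRepro2.CPolarA3
import Summits.Ventures.PercRepro2.CPolarA3Marks
import Summits.Ventures.PercRepro2.PendantClusterPins

/-!
# RELOCATING ONE END OF AN EDGE ALONG THE PINNED-OPEN REACH OF A VERTEX — the pattern masses,
`Gc`, (HCOV) and the one-edge Bernstein coefficients do not see it (blind cell PercRepro2, p5 g16;
`proofs/P5-OEDGE.md` §19)

Let `e = {u, z}` be a fractional edge and `u ∈ pinnedReach p ends r` (`u ↔ r` through edges of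
weight `1`). On every configuration of positive weight — for `p` and for either pin `p[e↦0]`,
`p[e↦1]` — `u ↔ r` without using `e`, so moving the end `u` of `e` to `r`
(`ends' = Function.update ends e s(r, z)`) changes no connection (`conn_reloc_iff`,
`conn_reloc_iff_ae`); the pinned-open reach of every vertex is unchanged (`pinnedReach_reloc`).
Hence every pattern mass of `Gc` agrees for two edge maps whose connections agree almost surely
(`prob_Q_cc` … `prob_c`), and so do `Gc`, (HCOV) and the Bernstein coefficients `B1`, `B2` of `e`
(**`Gc_congr`**, **`HCov_congr`**, **`B1_congr`**, **`B2_congr`**). Used in ReachRootEdge.lean: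
an edge joining the reach of `a₃` to the reach of a root is, almost surely, the cluster-root edge
`{r, z}` of ClusterRootBern.lean.
-/

namespace Summit.Ventures.PercRepro2

open UnionCluster CovForm CovForm.CPolarA3 PendantCluster

namespace EdgeReloc

/-! ## Relocating one end of an edge along an open path -/

section Conn

variable {V : Type*} {E : Type*} [DecidableEq E]

/-- Paths under `ends` are paths under `ends'` when `ends'` differs from `ends` only at `e`,
the old end `u` of `e` is joined to its new end `u'` without using `e`. -/
lemma conn_of_conn_reloc {ends ends' : E → Sym2 V} {e : E} {u u' z : V}
    (hoth : ∀ e', e' ≠ e → ends' e' = ends e') (he : ends e = s(u, z))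
    (he' : ends' e = s(u', z)) {ω : Config E}
    (hc : Conn ends' (Function.update ω e false) u u') {x y : V}
    (h : Conn ends ω x y) : Conn ends' ω x y := by
  refine mem_of_conn_of_closed (S := {w | Conn ends' ω x w}) ?_ (conn_refl ends' ω x) h
  intro a ha b hab
  rw [openGraph_adj] at hab
  obtain ⟨_, e', he'o, hends⟩ := hab
  by_cases hee : e' = e
  · subst hee
    rw [he] at hends
    have huz : Conn ends' ω u z :=
      conn_trans (conn_mono (update_false_le ω e') hc) (conn_of_openAdj ⟨e', he'o, he'⟩)
    rcases Sym2.eq_iff.1 hends with ⟨rfl, rfl⟩ | ⟨rfl, rfl⟩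
    · exact conn_trans ha huz
    · exact conn_trans ha (conn_symm huz)
  · exact conn_trans ha (conn_of_openAdj ⟨e', he'o, by rw [hoth e' hee]; exact hends⟩)

omit [DecidableEq E] in
/-- With `e` closed, connections do not see where `e` is attached. -/
lemma conn_reloc_of_closed {ends ends' : E → Sym2 V} {e : E}
    (hoth : ∀ e', e' ≠ e → ends' e' = ends e') {ω : Config E} (hω : ω e = false) {x y : V}
    (h : Conn ends ω x y) : Conn ends' ω x y := by
  refine SimpleGraph.Reachable.mono ?_ h
  intro a b hab
  rw [openGraph_adj] at hab ⊢
  obtain ⟨hne, e', he'o, hends⟩ := hab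
  have hee : e' ≠ e := fun h => by rw [h, hω] at he'o; exact Bool.false_ne_true he'o
  exact ⟨hne, e', he'o, by rw [hoth e' hee]; exact hends⟩

/-- **Relocation**: if the end `u` of `e = {u, z}` is joined to `a₁` without using `e`, moving
`e` to `{a₁, z}` changes no connection of `ω`. -/
lemma conn_reloc_iff {ends : E → Sym2 V} {e : E} {u z a₁ : V} (he : ends e = s(u, z))
    {ω : Config E} (hc : Conn ends (Function.update ω e false) u a₁) (x y : V) :
    Conn ends ω x y ↔ Conn (Function.update ends e s(a₁, z)) ω x y := by
  have hoth : ∀ e', e' ≠ e → Function.update ends e s(a₁, z) e' = ends e' :=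
    fun e' he' => Function.update_of_ne he' _ _
  constructor
  · exact conn_of_conn_reloc hoth he (Function.update_self e _ ends)
      (conn_reloc_of_closed hoth (by simp) hc)
  · exact conn_of_conn_reloc (fun e' he' => (hoth e' he').symm) (Function.update_self e _ ends) he
      (conn_symm hc)

end Conn

/-! ## Almost surely, along the pinned-open reach of a root -/

section AE

variable {V : Type*} {E : Type*} [Fintype E] [DecidableEq E] {R : Type*} [Field R]
  [LinearOrder R]

/-- On a configuration of positive weight for a weight vector agreeing with `p` off `e`, the pinned
configuration of `p` is dominated even after closing `e` (`e` fractional). -/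
lemma pinnedConfig_le_update_false {p q : E → R} {e : E} (hq : ∀ e', e' ≠ e → q e' = p e')
    (hf1 : p e ≠ 1) {ω : Config E} (hw : weight q ω ≠ 0) :
    pinnedConfig p ≤ Function.update ω e false := by
  intro e'
  by_cases hee : e' = e
  · subst hee
    have h : pinnedConfig p e' = false := by
      unfold pinnedConfig; rw [decide_eq_false_iff_not]; exact hf1
    rw [h]; exact Bool.false_le _
  · rw [Function.update_of_ne hee]
    by_cases h1 : p e' = 1
    · rw [open_of_weight_ne_zero hw (by rw [hq e' hee]; exact h1)]; exact Bool.le_true _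
    · have h : pinnedConfig p e' = false := by
        unfold pinnedConfig; rw [decide_eq_false_iff_not]; exact h1
      rw [h]; exact Bool.false_le _

/-- **Relocation almost surely**: for `e = {u, z}` fractional with `u` in the pinned-open reach of
`a₁`, on every configuration of positive weight (for `p` or either pin of `e`) the connections of
`ends` and of `ends` with `e` moved to `{a₁, z}` agree. -/
lemma conn_reloc_iff_ae {p q : E → R} {ends : E → Sym2 V} {e : E} {u z a₁ : V}
    (hq : ∀ e', e' ≠ e → q e' = p e') (hf1 : p e ≠ 1) (hu : u ∈ pinnedReach p ends a₁)
    (he : ends e = s(u, z)) {ω : Config E} (hw : weight q ω ≠ 0) (x y : V) :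
    Conn ends ω x y ↔ Conn (Function.update ends e s(a₁, z)) ω x y :=
  conn_reloc_iff he (conn_symm (conn_mono (pinnedConfig_le_update_false hq hf1 hw) hu)) x y

omit [Fintype E] in
/-- The pinned-open reach of any vertex is unchanged by relocating a fractional edge. -/
lemma pinnedReach_reloc (p : E → R) {ends : E → Sym2 V} {e : E} (hf1 : p e ≠ 1) (a₁ z v : V) :
    pinnedReach p (Function.update ends e s(a₁, z)) v = pinnedReach p ends v := by
  have hoth : ∀ e', e' ≠ e → Function.update ends e s(a₁, z) e' = ends e' :=
    fun e' he' => Function.update_of_ne he' _ _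
  have hcl : pinnedConfig p e = false := by
    unfold pinnedConfig; rw [decide_eq_false_iff_not]; exact hf1
  ext w
  exact ⟨conn_reloc_of_closed (fun e' he' => (hoth e' he').symm) hcl,
    conn_reloc_of_closed hoth hcl⟩

omit [Fintype E] [Field R] [LinearOrder R] in
/-- The weight vectors `p`, `p[e↦0]`, `p[e↦1]` all agree with `p` off `e`. -/
lemma update_agree_off (p : E → R) (e : E) (c : R) :
    ∀ e', e' ≠ e → Function.update p e c e' = p e' :=
  fun _ he' => Function.update_of_ne he' _ _

end AE

/-! ## The pattern masses of two almost-surely equivalent edge maps agree -/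

section Masses

variable {V : Type*} {E : Type*} [Fintype E] [DecidableEq E] {R : Type*} [Field R]

variable {q : E → R} {ends ends' : E → Sym2 V}
  (hH : ∀ ω, weight q ω ≠ 0 → ∀ x y, Conn ends ω x y ↔ Conn ends' ω x y)

include hH

/-- `P(Q ∩ {x ↔ y} ∩ {x′ ↔ y′})` agrees. -/
lemma prob_Q_cc (a₁ a₂ x y x' y' : V) :
    prob q (avoidAll ends a₂ {a₁} ∩ (connEvent ends x y ∩ connEvent ends x' y')) =
      prob q (avoidAll ends' a₂ {a₁} ∩ (connEvent ends' x y ∩ connEvent ends' x' y')) :=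
  prob_congr_of_weight q _ _ fun ω hw => by
    simp only [Set.mem_inter_iff, mem_connEvent, mem_avoidAll, Finset.mem_singleton, forall_eq,
      hH ω hw]

/-- `P(Q ∩ {x ↔ y})` agrees. -/
lemma prob_Q_c (a₁ a₂ x y : V) :
    prob q (avoidAll ends a₂ {a₁} ∩ connEvent ends x y) =
      prob q (avoidAll ends' a₂ {a₁} ∩ connEvent ends' x y) :=
  prob_congr_of_weight q _ _ fun ω hw => by
    simp only [Set.mem_inter_iff, mem_connEvent, mem_avoidAll, Finset.mem_singleton, forall_eq,
      hH ω hw]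

/-- `P(Q)` agrees. -/
lemma prob_Q (a₁ a₂ : V) : prob q (avoidAll ends a₂ {a₁}) = prob q (avoidAll ends' a₂ {a₁}) :=
  prob_congr_of_weight q _ _ fun ω hw => by
    simp only [mem_avoidAll, Finset.mem_singleton, forall_eq, hH ω hw]

/-- `P(T ∩ {x ↔ y})` agrees. -/
lemma prob_T_c (a₁ a₂ a₃ x y : V) :
    prob q (TEvent ends a₁ a₂ a₃ ∩ connEvent ends x y) =
      prob q (TEvent ends' a₁ a₂ a₃ ∩ connEvent ends' x y) :=
  prob_congr_of_weight q _ _ fun ω hw => by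
    simp only [Set.mem_inter_iff, mem_connEvent, TEvent, Set.mem_compl_iff, hH ω hw]

/-- `P(T ∩ {x ↔ y} ∩ {x′ ↔ y′})` agrees. -/
lemma prob_T_cc (a₁ a₂ a₃ x y x' y' : V) :
    prob q (TEvent ends a₁ a₂ a₃ ∩ (connEvent ends x y ∩ connEvent ends x' y')) =
      prob q (TEvent ends' a₁ a₂ a₃ ∩ (connEvent ends' x y ∩ connEvent ends' x' y')) :=
  prob_congr_of_weight q _ _ fun ω hw => by
    simp only [Set.mem_inter_iff, mem_connEvent, TEvent, Set.mem_compl_iff, hH ω hw]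

/-- `P(T)` agrees. -/
lemma prob_T (a₁ a₂ a₃ : V) : prob q (TEvent ends a₁ a₂ a₃) = prob q (TEvent ends' a₁ a₂ a₃) :=
  prob_congr_of_weight q _ _ fun ω hw => by
    simp only [TEvent, Set.mem_inter_iff, mem_connEvent, Set.mem_compl_iff, hH ω hw]

/-- `P(PD ∩ {x ↔ y})` agrees. -/
lemma prob_PD_c (a₁ a₂ a₃ x y : V) :
    prob q (PDEvent ends a₁ a₂ a₃ ∩ connEvent ends x y) =
      prob q (PDEvent ends' a₁ a₂ a₃ ∩ connEvent ends' x y) :=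
  prob_congr_of_weight q _ _ fun ω hw => by
    simp only [Set.mem_inter_iff, mem_connEvent, PDEvent, Dtilde, Set.mem_compl_iff, mem_inU,
      hH ω hw]

/-- `P(PD ∩ {x ↔ y} ∩ {x′ ↔ y′})` agrees. -/
lemma prob_PD_cc (a₁ a₂ a₃ x y x' y' : V) :
    prob q (PDEvent ends a₁ a₂ a₃ ∩ (connEvent ends x y ∩ connEvent ends x' y')) =
      prob q (PDEvent ends' a₁ a₂ a₃ ∩ (connEvent ends' x y ∩ connEvent ends' x' y')) :=
  prob_congr_of_weight q _ _ fun ω hw => by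
    simp only [Set.mem_inter_iff, mem_connEvent, PDEvent, Dtilde, Set.mem_compl_iff, mem_inU,
      hH ω hw]

/-- `P(PD)` agrees. -/
lemma prob_PD (a₁ a₂ a₃ : V) :
    prob q (PDEvent ends a₁ a₂ a₃) = prob q (PDEvent ends' a₁ a₂ a₃) :=
  prob_congr_of_weight q _ _ fun ω hw => by
    simp only [PDEvent, Dtilde, Set.mem_inter_iff, mem_connEvent, Set.mem_compl_iff, mem_inU,
      hH ω hw]

/-- `P(x ↔ y)` agrees. -/
lemma prob_c (x y : V) : prob q (connEvent ends x y) = prob q (connEvent ends' x y) :=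
  prob_congr_of_weight q _ _ fun ω hw => by simp only [mem_connEvent, hH ω hw]

/-- `Gc` agrees (every one of its pattern masses does). -/
theorem Gc_congr (o a₁ a₂ a₃ b : V) :
    Gc q ends o a₁ a₂ a₃ b = Gc q ends' o a₁ a₂ a₃ b := by
  unfold Gc DEF EQbo EQb3 EQb3o EQo EQ3 EQ3o PDb PDbo Do gap
  simp only [prob_Q_cc hH, prob_Q_c hH, prob_Q hH, prob_T_c hH, prob_T_cc hH, prob_T hH,
    prob_PD_c hH, prob_PD_cc hH, prob_PD hH, prob_c hH]

end Masses

section HCov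

variable {V : Type*} {E : Type*} [Fintype E] [DecidableEq E] {R : Type*} [Field R]
  [LinearOrder R] {q : E → R} {ends ends' : E → Sym2 V}

/-- (HCOV) agrees. -/
theorem HCov_congr (hH : ∀ ω, weight q ω ≠ 0 → ∀ x y, Conn ends ω x y ↔ Conn ends' ω x y)
    (o a₁ a₂ a₃ b : V) : HCov q ends o a₁ a₂ a₃ b ↔ HCov q ends' o a₁ a₂ a₃ b := by
  unfold HCov; rw [Gc_congr hH]

end HCov

/-! ## The Bernstein coefficients of `e` agree -/

section Bern

variable {V : Type*} {E : Type*} [Fintype E] [DecidableEq E] {R : Type*} [Field R]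

open EdgeLine

variable {p : E → R} {ends ends' : E → Sym2 V} {e : E}
  (hH₀ : ∀ ω, weight (Function.update p e 0) ω ≠ 0 → ∀ x y, Conn ends ω x y ↔ Conn ends' ω x y)
  (hH₁ : ∀ ω, weight (Function.update p e 1) ω ≠ 0 → ∀ x y, Conn ends ω x y ↔ Conn ends' ω x y)

include hH₀ hH₁

/-- `B1` agrees (the twelve masses at each pin do). -/
theorem B1_congr (o a₁ a₂ a₃ b : V) :
    B1 p ends o a₁ a₂ a₃ b e = B1 p ends' o a₁ a₂ a₃ b e := by
  unfold B1 EQbo EQb3 EQb3o EQo EQ3 EQ3o PDb PDbo Do gap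
  simp only [prob_Q_cc hH₀, prob_Q_c hH₀, prob_Q hH₀, prob_T_c hH₀, prob_T_cc hH₀, prob_T hH₀,
    prob_PD_c hH₀, prob_PD_cc hH₀, prob_PD hH₀, prob_c hH₀, prob_Q_cc hH₁, prob_Q_c hH₁,
    prob_Q hH₁, prob_T_c hH₁, prob_T_cc hH₁, prob_T hH₁, prob_PD_c hH₁, prob_PD_cc hH₁,
    prob_PD hH₁, prob_c hH₁]

/-- `B2` agrees. -/
theorem B2_congr (o a₁ a₂ a₃ b : V) :
    B2 p ends o a₁ a₂ a₃ b e = B2 p ends' o a₁ a₂ a₃ b e := by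
  unfold B2 EQbo EQb3 EQb3o EQo EQ3 EQ3o PDb PDbo Do gap
  simp only [prob_Q_cc hH₀, prob_Q_c hH₀, prob_Q hH₀, prob_T_c hH₀, prob_T_cc hH₀, prob_T hH₀,
    prob_PD_c hH₀, prob_PD_cc hH₀, prob_PD hH₀, prob_c hH₀, prob_Q_cc hH₁, prob_Q_c hH₁,
    prob_Q hH₁, prob_T_c hH₁, prob_T_cc hH₁, prob_T hH₁, prob_PD_c hH₁, prob_PD_cc hH₁,
    prob_PD hH₁, prob_c hH₁]

end Bern

end EdgeReloc

end Summit.Ventures.PercRepro2
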